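import Summits.CriticalPhenomena.PercolationContinuityZ3.Theorems.PercNearOneGluingNoHeavyLowerTailQuantitativeAntitheticMonotone
import HarnessLib

/-!
# The deletion reduction of the antithetic size law (BENCH rows M2-R101 / M2-R100, PROOFS §P69 (c),(g))

Support file (`--supports stmt-CriticalPhenomena-4575`), prover seat `prim-rate-mine-2` (lane prim-rate, constants-miner (c);
`run/shared/lean/prim/prim-rate/prim-rate-mine-2/PROOFS.md` §P69).  No definitions, no named facts, no sorries; standard axioms.

SETTING (the cube form of the antithetic functional of PROOFS §P68/§P69).  `α` = the finite set of ALL potential pairs; a graph is a pair set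
`P : Finset α`; a 2-colouring of `P` is `X ∩ P` (red) / `P \ X` (blue) for `X : Finset α` (each colouring of `P` arises from `2^(#α − #P)` sets `X`,
a uniform factor).  The terminal readers are 0/1-valued functions of the red pair set: `T X = [a ↔ x in X]`, `F X = [b ↔ x]`, `G X = [u ↔ x]`;
all the proof uses is: `F, G` are MONOTONE, and `T` VANISHES on pair sets avoiding `D` = the pairs at the weight vertex `a` (no pair at `a` ⇒ `a`
is isolated ⇒ `a ↮ x`).  The inflated antithetic functional of the graph `P` at constant `C` is
`Φ(P) := Σ_X (T(X∩P) + T(P∖X) + C)·(F(X∩P) − F(P∖X))·(G(X∩P) − G(P∖X)) = 2^(#α−#P) · 2·(C₀(P) + C·S(P))` (integers of §P68).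

* `CSH.antithetic_base_nonneg` — if NO pair of `P` lies in `D` then `Φ(P) = C·Σ_X (F−F′)(G−G′) ≥ 0` for `C ≥ 0` (antithetic Harris,
  `CSH.antithetic_sum_nonneg`): the one-line base of the reduction («a isolated ⇒ T ≡ 0 ⇒ Φ = 2C·S ≥ 0»).
* `CSH.antithetic_nonneg_of_deletion_mono` — **THEOREM ((D_a) ⟹ (A½), PROOFS §P69 (g))**: if deleting a pair AT `a` never increases the
  functional — `Φ(P.erase e) ≤ 2·Φ(P)` for every `P` and every `e ∈ P ∩ D` (the factor 2 is the inflation factor; on genuine colourings this is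
  `C₀(P−e) + C·S(P−e) ≤ C₀(P) + C·S(P)`, conjecture (D_a) of BENCH row M2-R101, verified in 22.6·10⁶ exact instances) — then `Φ(P) ≥ 0` for EVERY
  pair set `P`, i.e. (A½) `C₀ + C·S ≥ 0`, which by PROOFS §P68 (b) is the size law (S1) `M + C·Cov ≥ 0` for every weighted graph.
  PROOF: induction on `#(P ∩ D)`; strip the pairs at `a` one at a time; base `antithetic_base_nonneg`.
[cite: Harris1960, Lemma 4.1 (p. 16)] [cite: VandenbergHaggstromKahn2005, Thm. 1.3 (p. 6)]
-/

namespace Summit.CriticalPhenomena.PercolationContinuityZ3.Theorems.CSH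

open Finset
open scoped FinsetFamily

variable {α : Type*} [Fintype α] [DecidableEq α]

/-- **Base of the deletion reduction** (PROOFS §P69 (g)): if the reader `T` vanishes on every pair set avoiding `D` and the graph `P` has no
pair in `D` (the weight vertex `a` is isolated), then the inflated antithetic functional is `C` times the antithetic covariance sum of the two
monotone readers `F, G`, hence `≥ 0` for `C ≥ 0` (`CSH.antithetic_sum_nonneg`). [cite: Harris1960, Lemma 4.1 (p. 16)] -/
theorem antithetic_base_nonneg (T F G : Finset α → ℤ) (D P : Finset α) (C : ℚ) (hC : 0 ≤ C)
    (hT : ∀ X, Disjoint X D → T X = 0)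
    (hF01 : ∀ X, F X = 0 ∨ F X = 1) (hG01 : ∀ X, G X = 0 ∨ G X = 1)
    (hFmono : ∀ X Y, X ⊆ Y → F X ≤ F Y) (hGmono : ∀ X Y, X ⊆ Y → G X ≤ G Y)
    (hPD : Disjoint P D) :
    0 ≤ ∑ X : Finset α, ((T (X ∩ P) : ℚ) + (T (P \ X) : ℚ) + C) *
        (((F (X ∩ P) : ℚ) - (F (P \ X) : ℚ)) * ((G (X ∩ P) : ℚ) - (G (P \ X) : ℚ))) := by
  -- T vanishes on both readings
  have hT1 : ∀ X : Finset α, T (X ∩ P) = 0 := fun X =>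
    hT _ (disjoint_of_subset_left inter_subset_right hPD)
  have hT2 : ∀ X : Finset α, T (P \ X) = 0 := fun X =>
    hT _ (disjoint_of_subset_left sdiff_subset hPD)
  simp_rw [hT1, hT2, Int.cast_zero, zero_add]
  rw [← Finset.mul_sum]
  refine mul_nonneg hC ?_
  -- the antithetic covariance sum of the up-sets 𝒜 = {s : F(s ∩ P) = 1}, ℬ = {s : G(s ∩ P) = 1}
  set 𝒜 : Finset (Finset α) := univ.filter fun s => F (s ∩ P) = 1 with h𝒜
  set ℬ : Finset (Finset α) := univ.filter fun s => G (s ∩ P) = 1 with hℬ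
  have up𝒜 : IsUpperSet (𝒜 : Set (Finset α)) := by
    intro s t hst hs
    rw [Finset.mem_coe, h𝒜, mem_filter] at hs ⊢
    refine ⟨mem_univ _, ?_⟩
    have h1 := hFmono (s ∩ P) (t ∩ P) (inter_subset_inter_right hst)
    rcases hF01 (t ∩ P) with h | h
    · rw [hs.2, h] at h1; exact absurd h1 (by norm_num)
    · exact h
  have upℬ : IsUpperSet (ℬ : Set (Finset α)) := by
    intro s t hst hs
    rw [Finset.mem_coe, hℬ, mem_filter] at hs ⊢
    refine ⟨mem_univ _, ?_⟩
    have h1 := hGmono (s ∩ P) (t ∩ P) (inter_subset_inter_right hst)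
    rcases hG01 (t ∩ P) with h | h
    · rw [hs.2, h] at h1; exact absurd h1 (by norm_num)
    · exact h
  have key := antithetic_sum_nonneg up𝒜 upℬ
  -- identify the summands
  have hFi : ∀ s : Finset α, (F (s ∩ P) : ℤ) = if s ∈ 𝒜 then (1:ℤ) else 0 := fun s => by
    rcases hF01 (s ∩ P) with h | h <;> simp [h𝒜, h]
  have hGi : ∀ s : Finset α, (G (s ∩ P) : ℤ) = if s ∈ ℬ then (1:ℤ) else 0 := fun s => by
    rcases hG01 (s ∩ P) with h | h <;> simp [hℬ, h]
  have hsd : ∀ s : Finset α, P \ s = sᶜ ∩ P := fun s => by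
    ext y; simp [mem_sdiff, mem_inter, mem_compl, and_comm]
  have hsum : (∑ X : Finset α, ((F (X ∩ P) : ℚ) - (F (P \ X) : ℚ)) * ((G (X ∩ P) : ℚ) - (G (P \ X) : ℚ)))
      = ((∑ s : Finset α, ((if s ∈ 𝒜 then (1:ℤ) else 0) - (if sᶜ ∈ 𝒜 then (1:ℤ) else 0)) *
          ((if s ∈ ℬ then (1:ℤ) else 0) - (if sᶜ ∈ ℬ then (1:ℤ) else 0)) : ℤ) : ℚ) := by
    push_cast
    refine Finset.sum_congr rfl fun s _ => ?_
    rw [hsd s, hFi s, hFi sᶜ, hGi s, hGi sᶜ]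
    push_cast
    rfl
  rw [hsum]
  exact_mod_cast key

/-- **THEOREM ((D_a) ⟹ (A½)) — the deletion reduction of the antithetic size law** (PROOFS §P69 (g); BENCH rows M2-R101/M2-R100).
With monotone 0/1 readers `F, G`, a reader `T` vanishing on pair sets avoiding `D` (the pairs at the weight vertex `a`) and `C ≥ 0`: if for
every pair set `P` and every `e ∈ P ∩ D` the inflated antithetic functional satisfies `Φ(P.erase e) ≤ 2·Φ(P)` — i.e. `C₀(P−e) + C·S(P−e) ≤
C₀(P) + C·S(P)`, deleting a pair at `a` never increases the functional (conjecture (D_a)) — then `Φ(P) ≥ 0` for EVERY `P`, i.e. (A½)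
`C₀ + C·S ≥ 0` (⟹ the size law (S1) by PROOFS §P68 (b)).  Induction on `#(P ∩ D)`; base `antithetic_base_nonneg`.
[cite: VandenbergHaggstromKahn2005, Thm. 1.3 (p. 6)] [cite: Harris1960, Lemma 4.1 (p. 16)] -/
theorem antithetic_nonneg_of_deletion_mono (T F G : Finset α → ℤ) (D : Finset α) (C : ℚ) (hC : 0 ≤ C)
    (hT : ∀ X, Disjoint X D → T X = 0)
    (hF01 : ∀ X, F X = 0 ∨ F X = 1) (hG01 : ∀ X, G X = 0 ∨ G X = 1)
    (hFmono : ∀ X Y, X ⊆ Y → F X ≤ F Y) (hGmono : ∀ X Y, X ⊆ Y → G X ≤ G Y)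
    (hDa : ∀ (P : Finset α) (e : α), e ∈ P → e ∈ D →
      (∑ X : Finset α, ((T (X ∩ P.erase e) : ℚ) + (T (P.erase e \ X) : ℚ) + C) *
          (((F (X ∩ P.erase e) : ℚ) - (F (P.erase e \ X) : ℚ)) * ((G (X ∩ P.erase e) : ℚ) - (G (P.erase e \ X) : ℚ))))
        ≤ 2 * ∑ X : Finset α, ((T (X ∩ P) : ℚ) + (T (P \ X) : ℚ) + C) *
          (((F (X ∩ P) : ℚ) - (F (P \ X) : ℚ)) * ((G (X ∩ P) : ℚ) - (G (P \ X) : ℚ))))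
    (P : Finset α) :
    0 ≤ ∑ X : Finset α, ((T (X ∩ P) : ℚ) + (T (P \ X) : ℚ) + C) *
        (((F (X ∩ P) : ℚ) - (F (P \ X) : ℚ)) * ((G (X ∩ P) : ℚ) - (G (P \ X) : ℚ))) := by
  -- strong induction on the number of pairs of P at a
  suffices h : ∀ (n : ℕ) (Q : Finset α), (Q ∩ D).card = n →
      0 ≤ ∑ X : Finset α, ((T (X ∩ Q) : ℚ) + (T (Q \ X) : ℚ) + C) *
        (((F (X ∩ Q) : ℚ) - (F (Q \ X) : ℚ)) * ((G (X ∩ Q) : ℚ) - (G (Q \ X) : ℚ))) from h _ P rfl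
  intro n
  induction n using Nat.strong_induction_on with
  | _ n ih =>
    intro Q hQ
    by_cases hQD : Disjoint Q D
    · exact antithetic_base_nonneg T F G D Q C hC hT hF01 hG01 hFmono hGmono hQD
    · -- pick a pair of Q at a and delete it
      rw [Finset.not_disjoint_iff] at hQD
      obtain ⟨e, heQ, heD⟩ := hQD
      have hcard : ((Q.erase e) ∩ D).card < n := by
        have h1 : (Q.erase e) ∩ D = (Q ∩ D).erase e := by
          ext y; simp only [mem_inter, mem_erase]; tauto
        rw [h1, ← hQ]
        exact Finset.card_erase_lt_of_mem (mem_inter.2 ⟨heQ, heD⟩)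
      have hrec := ih _ hcard (Q.erase e) rfl
      have hstep := hDa Q e heQ heD
      linarith

end Summit.CriticalPhenomena.PercolationContinuityZ3.Theorems.CSH
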